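import Literature.InformationTheory.QuantumCodes.LiftedProduct
import Literature.InformationTheory.QuantumCodes.CSSEquivalence
import HarnessLib

/-!
# The `X ↔ Z` symmetry of lifted-product codes: `LP(A, B)` swapped is `LP(B*, A*)`; `LP(A, A*)` has `d_X = d_Z`

Source of the construction: P. Panteleev, G. Kalachev, *Quantum LDPC codes with almost linear minimum
distance*, IEEE Trans. Inform. Theory 68 (2022) = arXiv:2012.04068, §III.D [PanteleevKalachev2022LP]
(`H_X = [A ⊗ I, I ⊗ B]`, `H_Z = [I ⊗ B*, A* ⊗ I]`, `M*` the conjugate transpose; typed in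
`QuantumCodes/LiftedProduct.lean` as `LiftedProduct.xMatrix` / `zMatrix` / `blockStar`), and the printed remark of
§III.E (chunk p0012 L43-44): "for 𝒬 = LP(A,B) … when we change the roles of the matrices H_X and H_Z, we obtain the code 𝒬*
that is permutation equivalent to LP(B*,A*)" — PROVED here with the explicit permutation, for arbitrary block matrices over a
commutative ring of characteristic 2 (no element-wise commutation is needed for the identity itself). The `1 × 1` case is
the two-block / bivariate-bicycle symmetry `H_Z = [Bᵀ, Aᵀ]` ↦ `d_X = d_Z` of Bravyi–Cross–Gambetta–Maslov–Rall–Yoder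
[BravyiEtAl2024, Lemma 1] (typed for abelian two-block codes in `AbelianTwoBlockCodes.lean`).

## What is here (all PROVED, no named facts)

* `xEntry`, `zEntry`, `xMatrix_eq_of_xEntry`, `zMatrix_eq_of_zEntry` — product-free ENTRY FORMULAS of `𝔅(H_X)`, `𝔅(H_Z)`
  (the Kronecker factors `I` resolved into `if`s), so that census index identities `rowMatrix n cert.HX = 𝔅(H_X(A,B)) ∘ (ρ, σ)`
  are decidable by kernel evaluation (QEC census LP rows).

* `zMatrix_eq_submatrix_xMatrix_blockStar`, `xMatrix_eq_submatrix_zMatrix_blockStar` — in characteristic `2`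
  the check matrices of `LP(A,B)` are those of `LP(B*, A*)` with the roles of `X` and `Z` exchanged, up to the
  evident relabelling of rows and qubits (swap the two factors of every index pair; the two column blocks are NOT
  exchanged): `𝔅(H_Z(A,B)) = 𝔅(H_X(B*,A*)) ∘ (swap, swap)`, `𝔅(H_X(A,B)) = 𝔅(H_Z(B*,A*)) ∘ (swap, swap)`.
  (Over a general ring the second identity holds up to the sign of the `I ⊗ B` block; CSS codes in this tree
  are binary, so characteristic `2` is the relevant case.)
* `dZ_eq_dX_of_lp`, `dX_eq_dZ_of_lp`, `k_eq_k_of_lp` — for binary CSS codes `C = (𝔅H_X(A,B), 𝔅H_Z(A,B))` and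
  `C' = (𝔅H_X(B*,A*), 𝔅H_Z(B*,A*))`: `d_Z(C) = d_X(C')`, `d_X(C) = d_Z(C')`, `k(C) = k(C')`
  (via type-05's permutation invariance `CSSCode.reindex_dX/dZ/k`).
* `dX_eq_dZ_of_lp_self` — **every `LP(A, A*)` code has `d_X = d_Z`** (`(A*)* = A`, so `C' = C`): the quasi-cyclic
  `LP(A, A*)` family of [PanteleevKalachev2022LP, §III.D Example 3] is `X/Z`-balanced; used by the QEC census for
  one-sided certificates of lifted-product rows (qec-search-4).
Hypotheses are stated on an arbitrary `CSSCode` through `C.HX = xMatrix A B`, `C.HZ = zMatrix A B`, so they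
apply to `CSSCode.ofMatrices (xMatrix A B) (zMatrix A B) h` by `rfl`. Definitions: only the two relabelling bijections
`swapRows`, `swapCols` (abbreviations) and the entry functions `xEntry`, `zEntry`.
-/

namespace Literature.InformationTheory.QuantumCodes

open Matrix
open scoped Kronecker

namespace LiftedProduct

variable {F : Type*} {ℓ mA nA mB nB : Type*}

/-- The row relabelling `((j, u), a) ↦ ((u, j), a)` between the `Z`-checks of `LP(A,B)` (indexed by
`(n_A × n_B) × ℓ`) and the `X`-checks of `LP(B*, A*)` (indexed by `(n_B × n_A) × ℓ`), as a bijection — the explicit form of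
the printed «permutation equivalence». (abbreviation) [cite: PanteleevKalachev2022LP, §III.E (arXiv:2012.04068 chunk p0012 L43-44)] -/
abbrev swapRows (α β ℓ : Type*) : (α × β) × ℓ ≃ (β × α) × ℓ := (Equiv.prodComm α β).prodCongr (Equiv.refl ℓ)

/-- The qubit relabelling `(inl (j, s), a) ↦ (inl (s, j), a)`, `(inr (i, u), a) ↦ (inr (u, i), a)` between the
qubits of `LP(A,B)` and those of `LP(B*, A*)` (the two column blocks keep their places; inside each block the two
factors of the index pair are exchanged), as a bijection — the explicit form of the printed «permutation equivalence».
(abbreviation) [cite: PanteleevKalachev2022LP, §III.E (arXiv:2012.04068 chunk p0012 L43-44)] -/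
abbrev swapCols (α β γ δ ℓ : Type*) : ((α × β) ⊕ (γ × δ)) × ℓ ≃ ((β × α) ⊕ (δ × γ)) × ℓ :=
  ((Equiv.prodComm α β).sumCongr (Equiv.prodComm γ δ)).prodCongr (Equiv.refl ℓ)

section Entries

variable [CommRing F] [Fintype ℓ] [DecidableEq ℓ]
variable [DecidableEq mA] [DecidableEq mB] [DecidableEq nA] [DecidableEq nB]

/-- **Entry formula of `𝔅(H_X(A,B))`** as a plain function (no matrix products: the Kronecker factors `I` are
resolved into `if`s), for kernel evaluation of census index identities:
row `((i, s), a)`, column `(inl (j, s'), b) ↦ [s = s'] · (A i j)_{ab}`, column `(inr (i', u), b) ↦ −[i = i'] · (B s u)_{ab}`.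
(definition, computable) [cite: PanteleevKalachev2022LP, §III.D (arXiv:2012.04068 chunk p0011 L5-12): `H_X = [A ⊗ I, I ⊗ B]`] -/
def xEntry (A : Matrix mA nA (Matrix ℓ ℓ F)) (B : Matrix mB nB (Matrix ℓ ℓ F)) :
    (mA × mB) × ℓ → ((nA × mB) ⊕ (mA × nB)) × ℓ → F
  | ((i, s), a), (Sum.inl (j, s'), b) => if s = s' then A i j a b else 0
  | ((i, s), a), (Sum.inr (i', u), b) => if i = i' then -(B s u a b) else 0

/-- **Entry formula of `𝔅(H_Z(A,B))`**: row `((j, u), a)`, column `(inl (j', s), b) ↦ [j = j'] · (B s u)_{ba}`,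
column `(inr (i, u'), b) ↦ [u = u'] · (A i j)_{ba}` (the blocks of `M*` are transposed). (definition, computable)
[cite: PanteleevKalachev2022LP, §III.D (arXiv:2012.04068 chunk p0011 L5-12): `H_Z = [I ⊗ B*, A* ⊗ I]`] -/
def zEntry (A : Matrix mA nA (Matrix ℓ ℓ F)) (B : Matrix mB nB (Matrix ℓ ℓ F)) :
    (nA × nB) × ℓ → ((nA × mB) ⊕ (mA × nB)) × ℓ → F
  | ((j, u), a), (Sum.inl (j', s), b) => if j = j' then B s u b a else 0
  | ((j, u), a), (Sum.inr (i, u'), b) => if u = u' then A i j b a else 0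

omit [DecidableEq nA] [DecidableEq nB] in
/-- `𝔅(H_X(A,B))` entrywise = `xEntry A B`. [cite: PanteleevKalachev2022LP, §III.D (arXiv:2012.04068 chunk p0011 L5-12)] -/
theorem xMatrix_eq_of_xEntry (A : Matrix mA nA (Matrix ℓ ℓ F)) (B : Matrix mB nB (Matrix ℓ ℓ F)) :
    xMatrix A B = Matrix.of (xEntry A B) := by
  ext ⟨⟨i, s⟩, a⟩ ⟨c, b⟩
  rcases c with ⟨j, s'⟩ | ⟨i', u⟩
  · simp only [xMatrix, xMatrixR, comp_apply, fromCols_apply_inl, kroneckerMap_apply, Matrix.one_apply, of_apply, xEntry]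
    by_cases h : s = s'
    · subst h; simp
    · simp [h]
  · simp only [xMatrix, xMatrixR, comp_apply, fromCols_apply_inr, kroneckerMap_apply, Matrix.neg_apply, Matrix.one_apply,
      of_apply, xEntry]
    by_cases h : i = i'
    · subst h; simp
    · simp [h]

omit [DecidableEq mA] [DecidableEq mB] in
/-- `𝔅(H_Z(A,B))` entrywise = `zEntry A B`. [cite: PanteleevKalachev2022LP, §III.D (arXiv:2012.04068 chunk p0011 L5-12)] -/
theorem zMatrix_eq_of_zEntry (A : Matrix mA nA (Matrix ℓ ℓ F)) (B : Matrix mB nB (Matrix ℓ ℓ F)) :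
    zMatrix A B = Matrix.of (zEntry A B) := by
  ext ⟨⟨j, u⟩, a⟩ ⟨c, b⟩
  rcases c with ⟨j', s⟩ | ⟨i, u'⟩
  · simp only [zMatrix, zMatrixR, comp_apply, fromCols_apply_inl, kroneckerMap_apply, Matrix.one_apply, of_apply, zEntry,
      blockStar_apply]
    by_cases h : j = j'
    · subst h; simp
    · simp [h]
  · simp only [zMatrix, zMatrixR, comp_apply, fromCols_apply_inr, kroneckerMap_apply, Matrix.one_apply, of_apply, zEntry,
      blockStar_apply]
    by_cases h : u = u'
    · subst h; simp
    · simp [h]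

end Entries

section CharTwo

variable [CommRing F] [CharP F 2] [Fintype ℓ] [DecidableEq ℓ]
variable [DecidableEq mA] [DecidableEq mB] [DecidableEq nA] [DecidableEq nB]

omit [DecidableEq mA] [DecidableEq mB] in
/-- **`𝔅(H_Z(A,B))` is `𝔅(H_X(B*,A*))` relabelled** (characteristic `2`): entry by entry,
`(I ⊗ B*)_{(j,u),(j',s)} = δ_{jj'} B*_{us} = (B* ⊗ I)_{(u,j),(s,j')}` and
`(A* ⊗ I)_{(j,u),(i,u')} = A*_{ji} δ_{uu'} = -(I ⊗ A*)_{(u,j),(u',i)}` with `-1 = 1`.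
[cite: PanteleevKalachev2022LP, §III.E (arXiv:2012.04068 chunk p0012 L43-44: "when we change the roles of the matrices H_X and H_Z, we obtain the code Q* that is permutation equivalent to LP(B*,A*)")] -/
theorem zMatrix_eq_submatrix_xMatrix_blockStar (A : Matrix mA nA (Matrix ℓ ℓ F)) (B : Matrix mB nB (Matrix ℓ ℓ F)) :
    zMatrix A B = (xMatrix (blockStar B) (blockStar A)).submatrix (swapRows nA nB ℓ) (swapCols nA mB mA nB ℓ) := by
  ext ⟨⟨j, u⟩, a⟩ ⟨c, b⟩
  rcases c with ⟨j', s⟩ | ⟨i, u'⟩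
  · simp only [zMatrix, xMatrix, zMatrixR, xMatrixR, submatrix_apply, Equiv.prodCongr_apply, Equiv.coe_prodComm,
      Equiv.sumCongr_apply, Equiv.coe_refl, Prod.map_apply, Sum.map_inl, Prod.swap_prod_mk, id_eq, comp_apply,
      fromCols_apply_inl, kroneckerMap_apply, Matrix.one_apply]
    by_cases h : j = j'
    · subst h; simp
    · simp [h]
  · simp only [zMatrix, xMatrix, zMatrixR, xMatrixR, submatrix_apply, Equiv.prodCongr_apply, Equiv.coe_prodComm,
      Equiv.sumCongr_apply, Equiv.coe_refl, Prod.map_apply, Sum.map_inr, Prod.swap_prod_mk, id_eq, comp_apply,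
      fromCols_apply_inr, kroneckerMap_apply, Matrix.neg_apply, Matrix.one_apply]
    by_cases h : u = u'
    · subst h; simp [CharTwo.neg_eq]
    · simp [h]

omit [DecidableEq nA] [DecidableEq nB] in
/-- **`𝔅(H_X(A,B))` is `𝔅(H_Z(B*,A*))` relabelled** (characteristic `2`; `(M*)* = M`).
[cite: PanteleevKalachev2022LP, §III.E (arXiv:2012.04068 chunk p0012 L43-44: "when we change the roles of the matrices H_X and H_Z, we obtain the code Q* that is permutation equivalent to LP(B*,A*)")] -/
theorem xMatrix_eq_submatrix_zMatrix_blockStar (A : Matrix mA nA (Matrix ℓ ℓ F)) (B : Matrix mB nB (Matrix ℓ ℓ F)) :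
    xMatrix A B = (zMatrix (blockStar B) (blockStar A)).submatrix (swapRows mA mB ℓ) (swapCols nA mB mA nB ℓ) := by
  ext ⟨⟨i, s⟩, a⟩ ⟨c, b⟩
  rcases c with ⟨j, s'⟩ | ⟨i', u⟩
  · simp only [zMatrix, xMatrix, zMatrixR, xMatrixR, submatrix_apply, Equiv.prodCongr_apply, Equiv.coe_prodComm,
      Equiv.sumCongr_apply, Equiv.coe_refl, Prod.map_apply, Sum.map_inl, Prod.swap_prod_mk, id_eq, comp_apply,
      fromCols_apply_inl, kroneckerMap_apply, Matrix.one_apply, blockStar_apply, transpose_transpose]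
    by_cases h : s = s'
    · subst h; simp
    · simp [h]
  · simp only [zMatrix, xMatrix, zMatrixR, xMatrixR, submatrix_apply, Equiv.prodCongr_apply, Equiv.coe_prodComm,
      Equiv.sumCongr_apply, Equiv.coe_refl, Prod.map_apply, Sum.map_inr, Prod.swap_prod_mk, id_eq, comp_apply,
      fromCols_apply_inr, kroneckerMap_apply, Matrix.neg_apply, Matrix.one_apply, blockStar_apply, transpose_transpose]
    by_cases h : i = i'
    · subst h; simp [CharTwo.neg_eq]
    · simp [h]

end CharTwo

/-! ### Consequences for the binary CSS codes (FACT P of `CSSEquivalence.lean` applied to the swap) -/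

section CSS

variable [Fintype ℓ] [DecidableEq ℓ] [Fintype mA] [Fintype nA] [Fintype mB] [Fintype nB]
variable [DecidableEq mA] [DecidableEq mB] [DecidableEq nA] [DecidableEq nB]
variable {A : Matrix mA nA (Matrix ℓ ℓ (ZMod 2))} {B : Matrix mB nB (Matrix ℓ ℓ (ZMod 2))}
  {C : CSSCode ((mA × mB) × ℓ) ((nA × nB) × ℓ) (((nA × mB) ⊕ (mA × nB)) × ℓ)}
  {C' : CSSCode ((nB × nA) × ℓ) ((mB × mA) × ℓ) (((mB × nA) ⊕ (nB × mA)) × ℓ)}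

/-- **`d_Z(LP(A,B)) = d_X(LP(B*,A*))`** for binary CSS codes `C` with check matrices `𝔅H_X(A,B)`, `𝔅H_Z(A,B)`
and `C'` with check matrices `𝔅H_X(B*,A*)`, `𝔅H_Z(B*,A*)`: the swap of `C` has `C'`'s matrices along the
factor-swapping bijections, so type-05's FACT P (`CSSCode.dX_eq_of_submatrix`) applies.
[cite: PanteleevKalachev2022LP, §III.E (arXiv:2012.04068 chunk p0012 L43-44: "when we change the roles of the matrices H_X and H_Z, we obtain the code Q* that is permutation equivalent to LP(B*,A*)")] -/
theorem dZ_eq_dX_of_lp (hX : C.HX = xMatrix A B) (hZ : C.HZ = zMatrix A B)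
    (hX' : C'.HX = xMatrix (blockStar B) (blockStar A)) (hZ' : C'.HZ = zMatrix (blockStar B) (blockStar A)) :
    C.dZ = C'.dX := by
  rw [← CSSCode.dX_swap]
  exact CSSCode.dX_eq_of_submatrix (C := C') (C' := C.swap) (ρX := swapRows nA nB ℓ) (ρZ := swapRows mA mB ℓ)
    (σ := swapCols nA mB mA nB ℓ) (by rw [CSSCode.swap_HX, hZ, hX', zMatrix_eq_submatrix_xMatrix_blockStar])
    (by rw [CSSCode.swap_HZ, hX, hZ', xMatrix_eq_submatrix_zMatrix_blockStar])

/-- **`d_X(LP(A,B)) = d_Z(LP(B*,A*))`**. [cite: PanteleevKalachev2022LP, §III.E (arXiv:2012.04068 chunk p0012 L43-44: "when we change the roles of the matrices H_X and H_Z, we obtain the code Q* that is permutation equivalent to LP(B*,A*)")] -/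
theorem dX_eq_dZ_of_lp (hX : C.HX = xMatrix A B) (hZ : C.HZ = zMatrix A B)
    (hX' : C'.HX = xMatrix (blockStar B) (blockStar A)) (hZ' : C'.HZ = zMatrix (blockStar B) (blockStar A)) :
    C.dX = C'.dZ := by
  rw [← CSSCode.dZ_swap]
  exact CSSCode.dZ_eq_of_submatrix (C := C') (C' := C.swap) (ρX := swapRows nA nB ℓ) (ρZ := swapRows mA mB ℓ)
    (σ := swapCols nA mB mA nB ℓ) (by rw [CSSCode.swap_HX, hZ, hX', zMatrix_eq_submatrix_xMatrix_blockStar])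
    (by rw [CSSCode.swap_HZ, hX, hZ', xMatrix_eq_submatrix_zMatrix_blockStar])

/-- **`k(LP(A,B)) = k(LP(B*,A*))`**. [cite: PanteleevKalachev2022LP, §III.E (arXiv:2012.04068 chunk p0012 L43-44: "when we change the roles of the matrices H_X and H_Z, we obtain the code Q* that is permutation equivalent to LP(B*,A*)")] -/
theorem k_eq_k_of_lp (hX : C.HX = xMatrix A B) (hZ : C.HZ = zMatrix A B)
    (hX' : C'.HX = xMatrix (blockStar B) (blockStar A)) (hZ' : C'.HZ = zMatrix (blockStar B) (blockStar A)) :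
    C.k = C'.k := by
  rw [← CSSCode.k_swap]
  exact CSSCode.k_eq_of_submatrix (C := C') (C' := C.swap) (ρX := swapRows nA nB ℓ) (ρZ := swapRows mA mB ℓ)
    (σ := swapCols nA mB mA nB ℓ) (by rw [CSSCode.swap_HX, hZ, hX', zMatrix_eq_submatrix_xMatrix_blockStar])
    (by rw [CSSCode.swap_HZ, hX, hZ', xMatrix_eq_submatrix_zMatrix_blockStar])

/-- **The census predicate transfers**: `LP(A,B)` is `[[n,k,d]]` iff `LP(B*,A*)` is (`IsCode` reads `min(d_X, d_Z)`,
symmetric under the swap). [cite: PanteleevKalachev2022LP, §III.E (arXiv:2012.04068 chunk p0012 L43-44: "when we change the roles of the matrices H_X and H_Z, we obtain the code Q* that is permutation equivalent to LP(B*,A*)")] -/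
theorem isCode_iff_isCode_of_lp (hX : C.HX = xMatrix A B) (hZ : C.HZ = zMatrix A B)
    (hX' : C'.HX = xMatrix (blockStar B) (blockStar A)) (hZ' : C'.HZ = zMatrix (blockStar B) (blockStar A))
    (n k d : ℕ) : C.IsCode n k d ↔ C'.IsCode n k d := by
  have hk := k_eq_k_of_lp hX hZ hX' hZ'
  have hdx := dX_eq_dZ_of_lp hX hZ hX' hZ'
  have hdz := dZ_eq_dX_of_lp hX hZ hX' hZ'
  have hcard : Fintype.card (((nA × mB) ⊕ (mA × nB)) × ℓ) = Fintype.card (((mB × nA) ⊕ (nB × mA)) × ℓ) :=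
    Fintype.card_congr (swapCols nA mB mA nB ℓ)
  constructor
  · intro h
    have hpos : 0 < C.k := by rw [h.2.1]; exact h.k_pos
    have hpos' : 0 < C'.k := by rw [← hk]; exact hpos
    obtain ⟨h1, h2, h3⟩ := (C.isCode_iff hpos).1 h
    refine (C'.isCode_iff hpos').2 ⟨?_, ?_, ?_⟩
    · rw [← hcard]; exact h1
    · rw [← hk]; exact h2
    · rw [← hdz, ← hdx, min_comm]; exact h3
  · intro h
    have hpos' : 0 < C'.k := by rw [h.2.1]; exact h.k_pos
    have hpos : 0 < C.k := by rw [hk]; exact hpos'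
    obtain ⟨h1, h2, h3⟩ := (C'.isCode_iff hpos').1 h
    refine (C.isCode_iff hpos).2 ⟨?_, ?_, ?_⟩
    · rw [hcard]; exact h1
    · rw [hk]; exact h2
    · rw [hdx, hdz, min_comm]; exact h3

end CSS

section Self

variable [Fintype ℓ] [DecidableEq ℓ] [Fintype mA] [Fintype nA] [DecidableEq mA] [DecidableEq nA]

/-- **Every `LP(A, A*)` code has `d_X = d_Z`**: with `B = A*` the partner code `LP(B*, A*) = LP(A, A*)` is the
code itself (`(A*)* = A`), so `d_X(C) = d_Z(C)` by `dX_eq_dZ_of_lp`. The quasi-cyclic `LP(A, A*)` family of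
[PanteleevKalachev2022LP, §III.D Example 3] is therefore `X/Z`-balanced —
which licenses ONE-SIDED distance certificates for it (QEC census, cell D.1-lite, e.g. `[[96,18,6]]`, `[[128,22,8]]`).
[cite: PanteleevKalachev2022LP, §III.D Example 3 (arXiv:2012.04068 chunk p0011 L60-68: "B = A*, … LP(A) = LP(A, A*) of length N = ℓ(n² + m²)"); the `d_X = d_Z` corollary combines it with §III.E chunk p0012 L43-44] -/
theorem dX_eq_dZ_of_lp_self {A : Matrix mA nA (Matrix ℓ ℓ (ZMod 2))}
    {C : CSSCode ((mA × nA) × ℓ) ((nA × mA) × ℓ) (((nA × nA) ⊕ (mA × mA)) × ℓ)}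
    (hX : C.HX = xMatrix A (blockStar A)) (hZ : C.HZ = zMatrix A (blockStar A)) : C.dX = C.dZ := by
  have hAA : blockStar (blockStar A) = A := by ext i j a b; rfl
  have hX' : C.HX = xMatrix (blockStar (blockStar A)) (blockStar A) := by rw [hAA]; exact hX
  have hZ' : C.HZ = zMatrix (blockStar (blockStar A)) (blockStar A) := by rw [hAA]; exact hZ
  exact dX_eq_dZ_of_lp hX hZ hX' hZ'

end Self

end LiftedProduct

end Literature.InformationTheory.QuantumCodes
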